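/-
Copyright: cell `pub-balaban-gaps` (G2), seat ne6 (row NE7b), `prover-pub-balaban-gaps-ne6-g17-0`. Project licence.
-/
import Summits.QuantumFields.BalabanUV.T4Continuum.Spine.NE7b.CompactFibrePlaquetteMassSU2Explicit

/-!
# THE ASYMPTOTICALLY SHARP FLOOR OF THE `SU(2)` ONE-PLAQUETTE MASS, WITH RATE: `Z_{SU(2)}(β) ≥ (2√π)⁻¹·(1 − 1∕(2β))·β^{−3∕2}` for every `β > 0`
# (row NE7b, node U5c; MODEL, [folklore]; census V47 — Laplace's lower half by ELEMENTARY Taylor floors, no dominated convergence)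

Cell `pub-balaban-gaps` (G2 spine census) for the `pub-balaban` T⁴ crux NE7b (`T4WeightBudget.RelWeightBound`; NOT PRINTED, NOT PROVED).  Crux-route work under
`Spine/NE7b/`; imports the landed V41 `CompactFibrePlaquetteMassSU2Explicit` (which re-exports V40e's `integral_exp_neg_traceDeficit_eq`) + Mathlib's half-line Gaussian
moments (`integral_rpow_mul_exp_neg_mul_rpow`); no `def`, zero `sorry`, nothing of Bałaban's asserted.

THE LOCATED QUESTION.  V45 proves `f(β) = β^{3∕2}Z_{SU(2)}(β) → (2√π)⁻¹` (dominated convergence, no rate); V44 ∕ J3 give `f < (2√π)⁻¹` at every β and the floor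
`0.14493·β^{−3∕2}` (β ≥ 3∕4) from the small-β end.  QUESTION (V47): a floor that is SHARP AS β → ∞, with an explicit rate.  ANSWER ([folklore]; `Z = (2∕π)·G`,
`G(β) = ∫_{(0,π)} e^{−2β(1−cos ψ)} sin²ψ dψ`):
* §1 **`sq_sub_pow_four_div_three_le_sin_sq`**: `ψ² − ψ⁴∕3 ≤ sin²ψ` for `ψ ≥ 0` (Mathlib's `x − x³∕6 < sin x`; trivially when `ψ² > 6`); with `1 − cos ψ ≤ ψ²∕2`:
  **`gaussianPoly_le_weylIntegrand`**: `e^{−βψ²}(ψ² − ψ⁴∕3) ≤ e^{−2β(1−cos ψ)} sin²ψ` (`β ≥ 0`, `ψ ≥ 0`);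
* §2 the half-line Gaussian moments `∫₀^∞ ψ²e^{−βψ²} dψ = (√π∕4)·((√β)⁻¹)³`, `∫₀^∞ ψ⁴e^{−βψ²} dψ = (3√π∕8)·((√β)⁻¹)⁵` (`integral_sq_mul_exp_neg_mul_sq`,
  `integral_pow_four_mul_exp_neg_mul_sq`);
* §3 **`laplaceFloor_le_scaled_weylIntegral`** (`β > 0`): `(√π∕4)·(1 − 1∕(2β)) ≤ (√β)³·G(β)` — the polynomial–Gaussian minorant is NEGATIVE beyond `ψ = √3 < π`, so
  extending the integral to `(0, ∞)` only lowers it: no tail term;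
* §4 (Haar currency) **`laplaceFloor_le_scaled_plaquetteMass_SU2`**: `(2√π)⁻¹·(1 − 1∕(2β)) ≤ (√β)³·∫ e^{−β·Re tr(1−U)} dHaar_{SU(2)}(U)`,
  **`laplaceFloor_le_plaquetteMass_SU2`**: `(2√π)⁻¹(1 − 1∕(2β))·((√β)⁻¹)³ ≤ Z(β)`, and the RATE form **`limit_sub_scaled_plaquetteMass_SU2_le`**:
  `(2√π)⁻¹ − (√β)³·Z(β) ≤ (2√π)⁻¹∕(2β)` — with J3's `(√β)³Z < (2√π)⁻¹` this is `|f(β) − (2√π)⁻¹| ≤ 0.14105∕β` (the true next Laplace term is `(3∕16)(2√π)⁻¹∕β =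
  0.0529∕β`; by value the floor is `0.1410 ∕ 0.2539 ∕ 0.2750 ∕ 0.2807` at β = 1 ∕ 5 ∕ 20 ∕ 100 against f = `0.2153 ∕ 0.2712 ∕ 0.2794 ∕ 0.2816`; it beats V44's tangent floor
  for β > 1.03).

HONEST REMARKS.  (i) MODEL ∕ [folklore]: Haar calculus of ONE `SU(2)` plaquette variable; nothing of the interacting measure.  (ii) Lower half only; the upper half with
rate (`cos x ≤ 1 − x²∕2 + x⁴∕24`) is not treated — J3's monotone ceiling is already sharp in the constant.  (iii) N = 2 only.  (iv) (A3) ∕ (A1c) NOT asserted; NC-NE7b-α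
UNRULED.  BY-NAME EFFECT ON THE WALL: NONE.  NE7b NOT PRINTED ∕ NOT PROVED; spine PROVED 0∕9; rung (B)+1 on ONE finite T⁴ — NOT infinite volume, NOT the mass gap, NOT Clay.
HONEST DEPENDENCY: continuum YM on T⁴ ⇐ BetaPertH ∧ nine spine estimates (0/9 proved); BetaPertH ⇐ (D1) ∧ (D4) ∧ CAP+tail;
G-an2-4 gates asym, D1 and NE2/3/4.  This file changes none of it.
-/

set_option autoImplicit false

noncomputable section

open Real Set MeasureTheory
open Literature.MathematicalPhysics.QuantumFieldTheory (haarProbability)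
open Summit.QuantumFields.BalabanUV.T4Continuum.NE7b.CompactFibreSU2ClassIntegral (integral_exp_neg_traceDeficit_eq)

namespace Summit.QuantumFields.BalabanUV.T4Continuum.NE7b.CompactFibrePlaquetteMassSU2LaplaceFloor

/-! ### §1 Pointwise Taylor floors -/

/-- **`ψ² − ψ⁴∕3 ≤ sin²ψ` for `ψ ≥ 0`** (from Mathlib's `x − x³∕6 < sin x`; when `ψ² > 6` the left side is negative). [folklore] -/
theorem sq_sub_pow_four_div_three_le_sin_sq {ψ : ℝ} (h0 : 0 ≤ ψ) : ψ ^ 2 - ψ ^ 4 / 3 ≤ Real.sin ψ ^ 2 := by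
  rcases h0.eq_or_lt with h | hpos
  · rw [← h]; simp
  by_cases h6 : ψ ^ 2 ≤ 6
  · have hl0 : 0 ≤ ψ - ψ ^ 3 / 6 := by nlinarith
    have hsin : ψ - ψ ^ 3 / 6 ≤ Real.sin ψ := (Real.sin_gt_sub_cube hpos).le
    have hsq : (ψ - ψ ^ 3 / 6) ^ 2 ≤ Real.sin ψ ^ 2 := pow_le_pow_left₀ hl0 hsin 2
    nlinarith [sq_nonneg (ψ ^ 3)]
  · push Not at h6
    have : ψ ^ 2 - ψ ^ 4 / 3 < 0 := by nlinarith
    linarith [sq_nonneg (Real.sin ψ)]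

/-- **THE POLYNOMIAL–GAUSSIAN MINORANT OF THE WEYL INTEGRAND**: for `β ≥ 0` and `ψ ≥ 0`, `e^{−βψ²}·(ψ² − ψ⁴∕3) ≤ e^{−2β(1−cos ψ)}·sin²ψ`
(`1 − cos ψ ≤ ψ²∕2` and §1; when the polynomial is negative the right side is still `≥ 0`). [folklore] -/
theorem gaussianPoly_le_weylIntegrand {β ψ : ℝ} (hβ : 0 ≤ β) (h0 : 0 ≤ ψ) :
    Real.exp (-(β * ψ ^ 2)) * (ψ ^ 2 - ψ ^ 4 / 3) ≤ Real.exp (-(2 * β * (1 - Real.cos ψ))) * Real.sin ψ ^ 2 := by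
  have hcos : 1 - Real.cos ψ ≤ ψ ^ 2 / 2 := by linarith [Real.one_sub_sq_div_two_le_cos (x := ψ)]
  have hexp : Real.exp (-(β * ψ ^ 2)) ≤ Real.exp (-(2 * β * (1 - Real.cos ψ))) := Real.exp_le_exp.2 (by nlinarith)
  rcases le_or_gt 0 (ψ ^ 2 - ψ ^ 4 / 3) with hp | hn
  · exact mul_le_mul hexp (sq_sub_pow_four_div_three_le_sin_sq h0) hp (Real.exp_pos _).le
  · have h1 : Real.exp (-(β * ψ ^ 2)) * (ψ ^ 2 - ψ ^ 4 / 3) ≤ 0 := mul_nonpos_of_nonneg_of_nonpos (Real.exp_pos _).le hn.le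
    exact h1.trans (mul_nonneg (Real.exp_pos _).le (sq_nonneg _))

/-- Beyond `ψ² ≥ 3` the minorant is non-positive. -/
theorem gaussianPoly_nonpos {β ψ : ℝ} (h3 : 3 ≤ ψ ^ 2) : Real.exp (-(β * ψ ^ 2)) * (ψ ^ 2 - ψ ^ 4 / 3) ≤ 0 :=
  mul_nonpos_of_nonneg_of_nonpos (Real.exp_pos _).le (by nlinarith)

/-! ### §2 Half-line Gaussian moments with parameter `β` -/

/-- `∫₀^∞ ψ²·e^{−βψ²} dψ = (√π∕4)·((√β)⁻¹)³` for `β > 0`. [folklore] -/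
theorem integral_sq_mul_exp_neg_mul_sq {β : ℝ} (hβ : 0 < β) :
    ∫ ψ in Set.Ioi (0 : ℝ), ψ ^ 2 * Real.exp (-(β * ψ ^ 2)) = Real.sqrt Real.pi / 4 * ((Real.sqrt β)⁻¹) ^ 3 := by
  have h := integral_rpow_mul_exp_neg_mul_rpow (p := 2) (q := 2) two_pos (by norm_num) hβ
  have e : ∀ x ∈ Set.Ioi (0 : ℝ), x ^ (2 : ℝ) * Real.exp (-β * x ^ (2 : ℝ)) = x ^ 2 * Real.exp (-(β * x ^ 2)) := by
    intro x _
    rw [show (2 : ℝ) = ((2 : ℕ) : ℝ) by norm_num, Real.rpow_natCast, neg_mul]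
  rw [setIntegral_congr_fun measurableSet_Ioi e] at h
  have hG : Real.Gamma ((2 + 1) / 2) = Real.sqrt Real.pi / 2 := by
    rw [show ((2 : ℝ) + 1) / 2 = 1 / 2 + 1 by norm_num, Real.Gamma_add_one (by norm_num), Real.Gamma_one_half_eq]; ring
  have hb : β ^ (-(2 + 1) / 2 : ℝ) = ((Real.sqrt β)⁻¹) ^ 3 := by
    rw [show (-(2 + 1) / 2 : ℝ) = -((1 / 2) * 3) by norm_num, Real.rpow_neg hβ.le, Real.rpow_mul hβ.le, Real.sqrt_eq_rpow, inv_pow]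
    norm_num
  rw [h, hG, hb]
  ring

/-- `∫₀^∞ ψ⁴·e^{−βψ²} dψ = (3√π∕8)·((√β)⁻¹)⁵` for `β > 0`. [folklore] -/
theorem integral_pow_four_mul_exp_neg_mul_sq {β : ℝ} (hβ : 0 < β) :
    ∫ ψ in Set.Ioi (0 : ℝ), ψ ^ 4 * Real.exp (-(β * ψ ^ 2)) = 3 * Real.sqrt Real.pi / 8 * ((Real.sqrt β)⁻¹) ^ 5 := by
  have h := integral_rpow_mul_exp_neg_mul_rpow (p := 2) (q := 4) two_pos (by norm_num) hβ
  have e : ∀ x ∈ Set.Ioi (0 : ℝ), x ^ (4 : ℝ) * Real.exp (-β * x ^ (2 : ℝ)) = x ^ 4 * Real.exp (-(β * x ^ 2)) := by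
    intro x _
    rw [show (4 : ℝ) = ((4 : ℕ) : ℝ) by norm_num, show (2 : ℝ) = ((2 : ℕ) : ℝ) by norm_num, Real.rpow_natCast, Real.rpow_natCast, neg_mul]
  rw [setIntegral_congr_fun measurableSet_Ioi e] at h
  have hG : Real.Gamma ((4 + 1) / 2) = 3 * Real.sqrt Real.pi / 4 := by
    rw [show ((4 : ℝ) + 1) / 2 = 1 / 2 + 1 + 1 by norm_num, Real.Gamma_add_one (by norm_num), Real.Gamma_add_one (by norm_num),
      Real.Gamma_one_half_eq]; ring
  have hb : β ^ (-(4 + 1) / 2 : ℝ) = ((Real.sqrt β)⁻¹) ^ 5 := by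
    rw [show (-(4 + 1) / 2 : ℝ) = -((1 / 2) * 5) by norm_num, Real.rpow_neg hβ.le, Real.rpow_mul hβ.le, Real.sqrt_eq_rpow, inv_pow]
    norm_num
  rw [h, hG, hb]
  ring

/-! ### §3 The floor in Weyl's variable -/

/-- **LAPLACE's LOWER HALF WITH RATE**: for `β > 0`, `(√π∕4)·(1 − 1∕(2β)) ≤ (√β)³·∫_{(0,π)} e^{−2β(1−cos ψ)} sin²ψ dψ`.  The minorant `e^{−βψ²}(ψ² − ψ⁴∕3)` integrates
over `(0, π)` to at least its integral over `(0, ∞)` (it is `≤ 0` beyond `√3 < π`), which is `(√π∕4)(√β)⁻³ − (√π∕8)(√β)⁻⁵`. [folklore] -/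
theorem laplaceFloor_le_scaled_weylIntegral {β : ℝ} (hβ : 0 < β) :
    Real.sqrt Real.pi / 4 * (1 - 1 / (2 * β)) ≤ Real.sqrt β ^ 3 * ∫ ψ in Set.Ioo 0 Real.pi, Real.exp (-(2 * β * (1 - Real.cos ψ))) * Real.sin ψ ^ 2 := by
  have hπ := Real.pi_pos
  have hs : 0 < Real.sqrt β := Real.sqrt_pos.2 hβ
  have hs2 : Real.sqrt β ^ 2 = β := Real.sq_sqrt hβ.le
  -- integrability of the two Gaussian moments on ℝ
  have hi2 : Integrable (fun x : ℝ => x ^ 2 * Real.exp (-(β * x ^ 2))) := by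
    have h := integrable_rpow_mul_exp_neg_mul_sq hβ (s := 2) (by norm_num)
    refine (h.congr (ae_of_all _ fun x => ?_))
    simp only [Real.rpow_two, neg_mul]
  have h4 : ∀ x : ℝ, x ^ (4 : ℝ) = x ^ 4 := fun x => by
    rw [show (4 : ℝ) = ((4 : ℕ) : ℝ) by norm_num, Real.rpow_natCast]
  have hi4 : Integrable (fun x : ℝ => x ^ 4 * Real.exp (-(β * x ^ 2))) := by
    have h := integrable_rpow_mul_exp_neg_mul_sq hβ (s := 4) (by norm_num)
    refine (h.congr (ae_of_all _ fun x => ?_))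
    simp only [h4, neg_mul]
  have hmin : Integrable (fun x : ℝ => Real.exp (-(β * x ^ 2)) * (x ^ 2 - x ^ 4 / 3)) := by
    refine ((hi2.sub (hi4.const_mul (1 / 3))).congr (ae_of_all _ fun x => ?_))
    simp only [Pi.sub_apply]
    ring
  -- Step 1: the Weyl integrand dominates the minorant on `(0, π)`
  have hcont : Continuous fun ψ : ℝ => Real.exp (-(2 * β * (1 - Real.cos ψ))) * Real.sin ψ ^ 2 := by fun_prop
  have hIoo : IntegrableOn (fun ψ : ℝ => Real.exp (-(2 * β * (1 - Real.cos ψ))) * Real.sin ψ ^ 2) (Set.Ioo 0 Real.pi) :=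
    (hcont.integrableOn_Icc).mono_set Set.Ioo_subset_Icc_self
  have step1 : ∫ ψ in Set.Ioo 0 Real.pi, Real.exp (-(β * ψ ^ 2)) * (ψ ^ 2 - ψ ^ 4 / 3)
      ≤ ∫ ψ in Set.Ioo 0 Real.pi, Real.exp (-(2 * β * (1 - Real.cos ψ))) * Real.sin ψ ^ 2 :=
    setIntegral_mono_on hmin.integrableOn hIoo measurableSet_Ioo fun ψ hψ => gaussianPoly_le_weylIntegrand hβ.le hψ.1.le
  -- Step 2: `(0, ∞) = (0, π) ∪ [π, ∞)` and the minorant is `≤ 0` on `[π, ∞)`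
  have hsplit : ∫ ψ in Set.Ioi (0 : ℝ), Real.exp (-(β * ψ ^ 2)) * (ψ ^ 2 - ψ ^ 4 / 3)
      = (∫ ψ in Set.Ioo 0 Real.pi, Real.exp (-(β * ψ ^ 2)) * (ψ ^ 2 - ψ ^ 4 / 3))
        + ∫ ψ in Set.Ici Real.pi, Real.exp (-(β * ψ ^ 2)) * (ψ ^ 2 - ψ ^ 4 / 3) := by
    rw [← Set.Ioo_union_Ici_eq_Ioi hπ]
    exact setIntegral_union (Set.disjoint_left.2 fun x hx hx' => not_le.2 hx.2 hx') measurableSet_Ici hmin.integrableOn hmin.integrableOn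
  have htail : ∫ ψ in Set.Ici Real.pi, Real.exp (-(β * ψ ^ 2)) * (ψ ^ 2 - ψ ^ 4 / 3) ≤ 0 :=
    setIntegral_nonpos measurableSet_Ici fun ψ hψ => gaussianPoly_nonpos (by
      have : Real.pi ≤ ψ := hψ
      nlinarith [Real.pi_gt_three])
  have step2 : ∫ ψ in Set.Ioi (0 : ℝ), Real.exp (-(β * ψ ^ 2)) * (ψ ^ 2 - ψ ^ 4 / 3)
      ≤ ∫ ψ in Set.Ioo 0 Real.pi, Real.exp (-(β * ψ ^ 2)) * (ψ ^ 2 - ψ ^ 4 / 3) := by rw [hsplit]; linarith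
  -- Step 3: evaluate the half-line integral of the minorant
  have hval : ∫ ψ in Set.Ioi (0 : ℝ), Real.exp (-(β * ψ ^ 2)) * (ψ ^ 2 - ψ ^ 4 / 3)
      = Real.sqrt Real.pi / 4 * ((Real.sqrt β)⁻¹) ^ 3 - 1 / 3 * (3 * Real.sqrt Real.pi / 8 * ((Real.sqrt β)⁻¹) ^ 5) := by
    have e : ∀ x : ℝ, Real.exp (-(β * x ^ 2)) * (x ^ 2 - x ^ 4 / 3) = x ^ 2 * Real.exp (-(β * x ^ 2)) - 1 / 3 * (x ^ 4 * Real.exp (-(β * x ^ 2))) :=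
      fun x => by ring
    simp_rw [e]
    rw [integral_sub hi2.integrableOn (hi4.integrableOn.const_mul _), integral_const_mul, integral_sq_mul_exp_neg_mul_sq hβ,
      integral_pow_four_mul_exp_neg_mul_sq hβ]
  -- Step 4: multiply by `(√β)³`
  have hchain : Real.sqrt Real.pi / 4 * ((Real.sqrt β)⁻¹) ^ 3 - 1 / 3 * (3 * Real.sqrt Real.pi / 8 * ((Real.sqrt β)⁻¹) ^ 5)
      ≤ ∫ ψ in Set.Ioo 0 Real.pi, Real.exp (-(2 * β * (1 - Real.cos ψ))) * Real.sin ψ ^ 2 := by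
    rw [← hval]; exact step2.trans step1
  have hmul := mul_le_mul_of_nonneg_left hchain (pow_pos hs 3).le
  refine le_trans (le_of_eq ?_) hmul
  have hs3 : Real.sqrt β ^ 3 * ((Real.sqrt β)⁻¹) ^ 3 = 1 := by rw [inv_pow, mul_inv_cancel₀ (pow_pos hs 3).ne']
  have hs5 : Real.sqrt β ^ 3 * ((Real.sqrt β)⁻¹) ^ 5 = 1 / β := by
    rw [inv_pow, show (Real.sqrt β) ^ 5 = Real.sqrt β ^ 3 * Real.sqrt β ^ 2 by ring, hs2]
    field_simp
  calc Real.sqrt Real.pi / 4 * (1 - 1 / (2 * β))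
      = Real.sqrt Real.pi / 4 * (Real.sqrt β ^ 3 * ((Real.sqrt β)⁻¹) ^ 3) - Real.sqrt Real.pi / 8 * (Real.sqrt β ^ 3 * ((Real.sqrt β)⁻¹) ^ 5) := by
        rw [hs3, hs5]; ring
    _ = Real.sqrt β ^ 3 * (Real.sqrt Real.pi / 4 * ((Real.sqrt β)⁻¹) ^ 3 - 1 / 3 * (3 * Real.sqrt Real.pi / 8 * ((Real.sqrt β)⁻¹) ^ 5)) := by ring

/-! ### §4 Haar currency -/

/-- **THE ASYMPTOTICALLY SHARP FLOOR, SCALED FORM**: for `β > 0`, `(2√π)⁻¹·(1 − 1∕(2β)) ≤ (√β)³·∫ e^{−β·Re tr(1−U)} dHaar_{SU(2)}(U)`. [folklore] -/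
theorem laplaceFloor_le_scaled_plaquetteMass_SU2 {β : ℝ} (hβ : 0 < β) :
    (2 * Real.sqrt Real.pi)⁻¹ * (1 - 1 / (2 * β))
      ≤ Real.sqrt β ^ 3 * ∫ U, Real.exp (-(β * (Matrix.trace (1 - (U : Matrix (Fin 2) (Fin 2) ℂ))).re)) ∂(haarProbability (Matrix.specialUnitaryGroup (Fin 2) ℂ)) := by
  have hπ := Real.pi_pos
  have hsp : 0 < Real.sqrt Real.pi := Real.sqrt_pos.2 hπ
  have hss : Real.sqrt Real.pi * Real.sqrt Real.pi = Real.pi := Real.mul_self_sqrt hπ.le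
  rw [integral_exp_neg_traceDeficit_eq hβ.le]
  have h := mul_le_mul_of_nonneg_left (laplaceFloor_le_scaled_weylIntegral hβ) (by positivity : (0 : ℝ) ≤ 2 / Real.pi)
  have e1 : 2 / Real.pi * (Real.sqrt Real.pi / 4 * (1 - 1 / (2 * β))) = (2 * Real.sqrt Real.pi)⁻¹ * (1 - 1 / (2 * β)) := by
    have : 2 / Real.pi * (Real.sqrt Real.pi / 4) = (2 * Real.sqrt Real.pi)⁻¹ := by
      field_simp
      nlinarith [hss]
    rw [← mul_assoc, this]
  rw [e1] at h
  refine h.trans (le_of_eq ?_)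
  ring

/-- **THE ASYMPTOTICALLY SHARP FLOOR**: for `β > 0`, `(2√π)⁻¹·(1 − 1∕(2β))·((√β)⁻¹)³ ≤ ∫ e^{−β·Re tr(1−U)} dHaar_{SU(2)}(U)` — by value `0.1410·β^{−3∕2}` at β = 1,
`0.2539·β^{−3∕2}` at β = 5, `0.2807·β^{−3∕2}` at β = 100 (V44's tangent floor `0.14493` is better only for β < 1.03; the constant tends to the truth `0.28209`). [folklore] -/
theorem laplaceFloor_le_plaquetteMass_SU2 {β : ℝ} (hβ : 0 < β) :
    (2 * Real.sqrt Real.pi)⁻¹ * (1 - 1 / (2 * β)) * ((Real.sqrt β)⁻¹) ^ 3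
      ≤ ∫ U, Real.exp (-(β * (Matrix.trace (1 - (U : Matrix (Fin 2) (Fin 2) ℂ))).re)) ∂(haarProbability (Matrix.specialUnitaryGroup (Fin 2) ℂ)) := by
  have hs : 0 < Real.sqrt β := Real.sqrt_pos.2 hβ
  have h := laplaceFloor_le_scaled_plaquetteMass_SU2 hβ
  rw [inv_pow, ← div_eq_mul_inv, div_le_iff₀ (pow_pos hs 3)]
  linarith

/-- **THE RATE OF THE LAPLACE LIMIT FROM BELOW**: for `β > 0`, `(2√π)⁻¹ − (√β)³·Z_{SU(2)}(β) ≤ (2√π)⁻¹∕(2β)` (`= 0.14105∕β`; the true next Laplace term is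
`(3∕16)(2√π)⁻¹∕β = 0.0529∕β`).  With J3's `(√β)³Z < (2√π)⁻¹`: `|(√β)³Z(β) − (2√π)⁻¹| ≤ (2√π)⁻¹∕(2β)`. [folklore] -/
theorem limit_sub_scaled_plaquetteMass_SU2_le {β : ℝ} (hβ : 0 < β) :
    (2 * Real.sqrt Real.pi)⁻¹
        - Real.sqrt β ^ 3 * ∫ U, Real.exp (-(β * (Matrix.trace (1 - (U : Matrix (Fin 2) (Fin 2) ℂ))).re)) ∂(haarProbability (Matrix.specialUnitaryGroup (Fin 2) ℂ))
      ≤ (2 * Real.sqrt Real.pi)⁻¹ / (2 * β) := by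
  have h := laplaceFloor_le_scaled_plaquetteMass_SU2 hβ
  have e : (2 * Real.sqrt Real.pi)⁻¹ * (1 - 1 / (2 * β)) = (2 * Real.sqrt Real.pi)⁻¹ - (2 * Real.sqrt Real.pi)⁻¹ / (2 * β) := by ring
  linarith

end Summit.QuantumFields.BalabanUV.T4Continuum.NE7b.CompactFibrePlaquetteMassSU2LaplaceFloor

end
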